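import Mathlib
import HarnessLib
import Summits.HubbardSuperconductivity.HubbardSuperconductivity.Theorems.KLProgrammeC4aAbsBubbleLevelLoop

/-!
# Route `KLProgramme` — crux C4a, S3 brick (B4)/(B5) «(B4)-ABS-BUBBLE», part 5: the RELATIVE dichotomies — the currency in which
# `…C4aLoopNondegeneracy` delivers the geometry (smallness of `|ē − e|` and `|∂_φē|`, not of `|ē|`)

Cell `gate-hubbard-kl`, seat hubbard-kl-k3c3-p3 (g26; row «implicit-function / monotonicity route for μ(n)»).  Located brick for the (C)-closer lane
hubbard-kl-c4a-1 (stub (C) `stub_twoLeg_curvature` of `KLRegimeEngineV17F2`, stmt-HubbardSuperconductivity-20437), C4A-PLAN §24.4–§24.6 (B4)/(B5),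
HOME/hubbard-kl-k3c3-p3/B4-ABS-BUBBLE.md §3.  Sequel of `…C4aAbsBubbleLevelLoop`.

`…C4aLoopNondegeneracy.loop_nondegeneracy_directSheet` (p614274) reads, contrapositively: away from the Cooper configuration and outside the tangency
corner, `α·|∂_φē| + β·|ē − e| ≥ γ > 0` — a dichotomy on the partner level RELATIVE to the loop level.  Since the envelope floor satisfies `t ≥ |e|`
(finer-line split), the relative form is as good as the absolute one: for `|e| ≤ κ/2` the absolute dichotomy holds with `κ/2`, for `|e| > κ/2` the
trivial bound `(b − a)/t ≤ 2(b − a)/κ` is already of the right size (exactly as at the Cooper configuration, part 3).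

* `integral_inv_envelope_le_of_rel_dichotomy_one`: `|g − e| ≤ κ → c₁ ≤ |g′|`, `(b − a)·4L₁ ≤ N·κ`, `|e| ≤ κ/2` ⟹
  `∫ dx/max(t,|g|) ≤ 4(b − a)/κ + (2N/c₁)·log⁺(κ/(4t))` (= `integral_inv_envelope_le_cooper` at unit scale; the assembled level × loop form is
  `level_loop_inv_envelope_le_cooper` with `η := 1`, or any fixed scale).
* `integral_inv_envelope_le_of_rel_dichotomy_two`: `|g − e| ≤ κ → |g′| < c₁ → c₂ ≤ |g″|` ⟹ `≤ 4(b − a)/κ + (4N/c₁)·log⁺(κ/(4t)) + 12N/√(c₂t)`.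
* `intervalIntegral_level_layer_threshold_le`: the level layer with a threshold `θ₀` and a fold term (`I ≤ Q + R·log⁺(θ₀/(2e)) + S/√e` below `θ₀`,
  `I ≤ P/e` above) ⟹ `∫ w·I ≤ W·((Q + 2R)θ₀ + 2S√θ₀ + P·log⁺(hi/θ₀))`.
* **`level_loop_inv_envelope_le_of_rel_dichotomy_two`** (RELATIVE FOLD CLASS, ASSEMBLED — the tangency window): `lo`-free bound
  `W·((4(b−a)/κ + 8N/c₁)·(κ/2) + 2·(12N/√c₂)·√(κ/2) + (b − a)·log⁺(2hi/κ))`.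
Carrier-free; no integrability hypotheses; nothing about the Hubbard model's sizes; nothing asserts (C), K3 or superconductivity.
References: Salmhofer, Renormalization (1999) §4.5.3 Lemma 4.10 / Cor. 4.11 [cite: Salmhofer1999]; FST II, CPAM 51 (1998) §3
[cite: FeldmanSalmhoferTrubowitz1998]; BGM 2006 §2.4, App. A2 [cite: BenfattoGiulianiMastropietro2006].
-/

noncomputable section

namespace Summit.HubbardSuperconductivity.HubbardSuperconductivity.Theorems.C4a

set_option linter.dupNamespace false -- summit = problem name (single-conjunct summit), D-0017

open Real Set Filter MeasureTheory intervalIntegral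
open scoped Topology ENNReal

/-! ## §8 RELATIVE dichotomies (the form `…C4aLoopNondegeneracy` delivers: smallness of `|ē − e|`, not of `|ē|`) -/

section Relative

variable {g : ℝ → ℝ} {a b lo hi : ℝ}

/-- **RELATIVE FIRST-ORDER DICHOTOMY** `|g x − e| ≤ κ → c₁ ≤ |g′ x|` (ceiling `L₁`, `(b − a)·4L₁ ≤ N·κ`): for the small levels `|e| ≤ κ/2`,
`∫_{[a,b]} dx/max(t,|g x|) ≤ 4(b − a)/κ + (2N/c₁)·log⁺(κ/(4t))` — `integral_inv_envelope_le_cooper` at unit scale.  This is the currency of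
`…C4aLoopNondegeneracy.loop_nondegeneracy_directSheet` (away from (C)/(T): `|ē − e|` and `|∂_φē|` are not both small); the large levels `|e| > κ/2` are priced by
`integral_inv_envelope_le_trivial` (`(b − a)/t ≤ 2(b − a)/κ`). -/
theorem integral_inv_envelope_le_of_rel_dichotomy_one (hab : a ≤ b) (hg : ContDiff ℝ 1 g) {e κ c₁ L₁ t : ℝ} {N : ℕ} (hκ : 0 < κ) (hc₁ : 0 < c₁)
    (hL₁ : 0 < L₁) (hL : ∀ x ∈ Icc a b, |deriv g x| ≤ L₁) (hdich : ∀ x ∈ Icc a b, |g x - e| ≤ κ → c₁ ≤ |deriv g x|)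
    (hN : (b - a) * (4 * L₁) ≤ N * κ) (he : |e| ≤ κ / 2) (ht : 0 < t) :
    ∫ x in Icc a b, (max t |g x|)⁻¹ ≤ 4 * (b - a) / κ + N * (2 / c₁) * log⁺ (κ / (4 * t)) := by
  have h := integral_inv_envelope_le_cooper hab hg (r := 1) (c₀ := κ) (c₁ := c₁) (L₁ := L₁) one_pos hκ hc₁ hL₁
    (fun x hx => by rw [mul_one]; exact hL x hx) (fun x hx hgx => by rw [mul_one] at hgx ⊢; exact hdich x hx hgx) hN (by rwa [mul_one]) ht
  simpa using h

/-- **RELATIVE SECOND-ORDER DICHOTOMY** `|g x − e| ≤ κ → |g′ x| < c₁ → c₂ ≤ |g″ x|` (ceilings `L₁, L₂`, `(b − a)·4L₁ ≤ N·κ`, `(b − a)·4L₂ ≤ N·c₁`): for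
`|e| ≤ κ/2`, `∫_{[a,b]} dx/max(t,|g x|) ≤ 4(b − a)/κ + (4N/c₁)·log⁺(κ/(4t)) + 12N/√(c₂t)` (the absolute dichotomy holds with `κ/2`).  The currency of the
tangency window: outside the loop-angle window `|ē − e| + |∂_φē|` is bounded below (`…C4aLoopNondegeneracy`), inside it the curvature floor holds
(`…C4aTwoNodeCurvatureWindow`). -/
theorem integral_inv_envelope_le_of_rel_dichotomy_two (hab : a ≤ b) (hg : ContDiff ℝ 2 g) {e κ c₁ c₂ L₁ L₂ t : ℝ} {N : ℕ} (hκ : 0 < κ)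
    (hc₁ : 0 < c₁) (hc₂ : 0 < c₂) (hL₁ : 0 < L₁) (hL₂ : 0 < L₂) (hL : ∀ x ∈ Icc a b, |deriv g x| ≤ L₁)
    (hL' : ∀ x ∈ Icc a b, |iteratedDeriv 2 g x| ≤ L₂) (hdich : ∀ x ∈ Icc a b, |g x - e| ≤ κ → |deriv g x| < c₁ → c₂ ≤ |iteratedDeriv 2 g x|)
    (hN : (b - a) * (4 * L₁) ≤ N * κ) (hN' : (b - a) * (4 * L₂) ≤ N * c₁) (he : |e| ≤ κ / 2) (ht : 0 < t) :
    ∫ x in Icc a b, (max t |g x|)⁻¹ ≤ 4 * (b - a) / κ + N * (4 / c₁) * log⁺ (κ / (4 * t)) + 12 * N / Real.sqrt (c₂ * t) := by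
  have hdich' : ∀ x ∈ Icc a b, |g x| ≤ κ / 2 → |deriv g x| < c₁ → c₂ ≤ |iteratedDeriv 2 g x| := fun x hx hgx => by
    refine hdich x hx ?_
    calc |g x - e| ≤ |g x| + |e| := abs_sub _ _
      _ ≤ κ / 2 + κ / 2 := add_le_add hgx he
      _ = κ := by ring
  have hN2 : (b - a) * (2 * L₁) ≤ N * (κ / 2) := by linarith
  have h := integral_inv_envelope_le_of_dichotomy_two hab hg (half_pos hκ) hc₁ hc₂ hL₁ hL₂ hL hL' hdich' hN2 hN' ht
  refine h.trans (le_of_eq ?_)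
  have e1 : κ / 2 / (2 * t) = κ / (4 * t) := by ring
  rw [e1]
  field_simp
  ring

/-- **THE LEVEL LAYER WITH A THRESHOLD** (relative classes): `0 < lo ≤ hi`, threshold `θ₀ > 0`, weight `0 ≤ w ≤ W`, and loop-angle bounds `0 ≤ I e`,
`I e ≤ Q + R·log⁺(θ₀/(2e)) + S/√e` for `e ≤ θ₀` and `I e ≤ P/e` for `θ₀ < e` ⟹ `∫_{lo..hi} w·I ≤ W·((Q + 2R)θ₀ + 2S√θ₀ + P·log⁺(hi/θ₀))`.
(`intervalIntegral_level_layer_cooper_le` is the case `S = 0`; no integrability hypothesis.) -/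
theorem intervalIntegral_level_layer_threshold_le (hlo : 0 < lo) (hlohi : lo ≤ hi) {w I : ℝ → ℝ} {W P Q R S θ₀ : ℝ} (hθ₀ : 0 < θ₀)
    (hW : 0 ≤ W) (hP : 0 ≤ P) (hQ : 0 ≤ Q) (hR : 0 ≤ R) (hS : 0 ≤ S) (hw0 : ∀ e ∈ Icc lo hi, 0 ≤ w e) (hw : ∀ e ∈ Icc lo hi, w e ≤ W)
    (hI0 : ∀ e ∈ Icc lo hi, 0 ≤ I e) (hIs : ∀ e ∈ Icc lo hi, e ≤ θ₀ → I e ≤ Q + R * log⁺ (θ₀ / (2 * e)) + S * (Real.sqrt e)⁻¹)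
    (hIl : ∀ e ∈ Icc lo hi, θ₀ < e → I e ≤ P / e) :
    ∫ e in lo..hi, w e * I e ≤ W * ((Q + 2 * R) * θ₀ + 2 * S * Real.sqrt θ₀ + P * log⁺ (hi / θ₀)) := by
  have hhi : 0 < hi := hlo.trans_le hlohi
  by_cases hint : IntervalIntegrable (fun e => w e * I e) volume lo hi
  swap
  · rw [intervalIntegral.integral_undef hint]
    have := Real.posLog_nonneg (x := hi / θ₀)
    positivity
  set m : ℝ := max lo (min θ₀ hi) with hm
  have hlom : lo ≤ m := le_max_left _ _
  have hmhi : m ≤ hi := max_le hlohi (min_le_right _ _)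
  have hm0 : 0 < m := hlo.trans_le hlom
  have hi1 : IntervalIntegrable (fun e => w e * I e) volume lo m :=
    hint.mono_set (by rw [uIcc_of_le hlohi, uIcc_of_le hlom]; exact Icc_subset_Icc le_rfl hmhi)
  have hi2 : IntervalIntegrable (fun e => w e * I e) volume m hi :=
    hint.mono_set (by rw [uIcc_of_le hlohi, uIcc_of_le hmhi]; exact Icc_subset_Icc hlom le_rfl)
  rw [← intervalIntegral.integral_add_adjacent_intervals hi1 hi2]
  -- small levels
  have hsmall : ∫ e in lo..m, w e * I e ≤ W * ((Q + 2 * R) * θ₀ + 2 * S * Real.sqrt θ₀) := by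
    rcases eq_or_lt_of_le hlom with heq | hlt
    · rw [← heq, intervalIntegral.integral_same]; positivity
    have hmθ : m ≤ θ₀ := by
      have hlox : lo ≤ min θ₀ hi := by
        have h := hlt
        rw [hm, lt_max_iff] at h
        rcases h with h | h
        · exact absurd h (lt_irrefl _)
        · exact h.le
      have : m = min θ₀ hi := by rw [hm, max_eq_right hlox]
      rw [this]; exact min_le_left _ _
    have h1 := intervalIntegral_level_layer_le hlo hlom (w := w) (I := I) (κ := θ₀ / 2) (A := Q) (B := R) (C := S) hW hQ hR hS
      (fun e he => hw0 e ⟨he.1, he.2.trans hmhi⟩) (fun e he => hw e ⟨he.1, he.2.trans hmhi⟩)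
      (fun e he => hI0 e ⟨he.1, he.2.trans hmhi⟩) fun e he => by
        have := hIs e ⟨he.1, he.2.trans hmhi⟩ (he.2.trans hmθ)
        rwa [div_div]
    refine h1.trans (mul_le_mul_of_nonneg_left ?_ hW)
    have hy : 0 ≤ θ₀ / 2 / m := by positivity
    have hlogle : log⁺ (θ₀ / 2 / m) ≤ θ₀ / 2 / m := by
      rw [Real.posLog_apply]
      exact max_le hy ((Real.log_le_sub_one_of_pos (by positivity)).trans (by linarith))
    have hml : m - lo ≤ m := by linarith
    have hml0 : 0 ≤ m - lo := sub_nonneg.2 hlom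
    have key : log⁺ (θ₀ / 2 / m) * (m - lo) ≤ θ₀ / 2 := by
      calc log⁺ (θ₀ / 2 / m) * (m - lo) ≤ (θ₀ / 2 / m) * m := mul_le_mul hlogle hml hml0 hy
        _ = θ₀ / 2 := by field_simp
    have e1 : (Q + R * (1 + log⁺ (θ₀ / 2 / m))) * (m - lo) = Q * (m - lo) + R * (m - lo) + R * (log⁺ (θ₀ / 2 / m) * (m - lo)) := by ring
    have h1' := mul_le_mul_of_nonneg_left (hml.trans hmθ) hQ
    have h2' := mul_le_mul_of_nonneg_left (hml.trans hmθ) hR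
    have h3' : R * (log⁺ (θ₀ / 2 / m) * (m - lo)) ≤ R * θ₀ := mul_le_mul_of_nonneg_left (key.trans (by linarith)) hR
    have h4' : 2 * S * Real.sqrt m ≤ 2 * S * Real.sqrt θ₀ := mul_le_mul_of_nonneg_left (Real.sqrt_le_sqrt hmθ) (by positivity)
    rw [e1]
    nlinarith
  -- large levels
  have hlarge : ∫ e in m..hi, w e * I e ≤ W * (P * log⁺ (hi / θ₀)) := by
    rcases eq_or_lt_of_le hmhi with heq | hlt
    · rw [heq, intervalIntegral.integral_same]; exact mul_nonneg hW (mul_nonneg hP Real.posLog_nonneg)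
    have hθm : θ₀ ≤ m := by
      by_contra hcon
      push Not at hcon
      have : min θ₀ hi ≤ m := le_max_right _ _
      rcases le_total θ₀ hi with h | h
      · rw [min_eq_left h] at this; exact absurd this (not_le.2 hcon)
      · have : hi ≤ m := by rw [min_eq_right h] at this; exact this
        exact absurd hlt (not_lt.2 this)
    have hmaj : IntervalIntegrable (fun e => W * (P * e⁻¹)) volume m hi := by
      refine (ContinuousOn.intervalIntegrable ?_)
      rw [uIcc_of_le hmhi]
      exact continuousOn_const.mul (continuousOn_const.mul (continuousOn_inv₀.mono fun e he => (hm0.trans_le he.1).ne'))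
    have hle : ∫ e in m..hi, w e * I e ≤ ∫ e in m..hi, W * (P * e⁻¹) := by
      rw [intervalIntegral.integral_of_le hmhi, intervalIntegral.integral_of_le hmhi]
      refine integral_mono_of_nonneg ?_ hmaj.1 ?_
      · refine (ae_restrict_iff' measurableSet_Ioc).2 (Eventually.of_forall fun e he => ?_)
        exact mul_nonneg (hw0 e ⟨hlom.trans he.1.le, he.2⟩) (hI0 e ⟨hlom.trans he.1.le, he.2⟩)
      · refine (ae_restrict_iff' measurableSet_Ioc).2 (Eventually.of_forall fun e he => ?_)
        have he' : e ∈ Icc lo hi := ⟨hlom.trans he.1.le, he.2⟩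
        calc w e * I e ≤ W * (P / e) := mul_le_mul (hw e he') (hIl e he' (hθm.trans_lt he.1)) (hI0 e he') hW
          _ = W * (P * e⁻¹) := by rw [div_eq_mul_inv]
    refine hle.trans ?_
    rw [intervalIntegral.integral_const_mul, intervalIntegral.integral_const_mul, integral_inv_of_pos hm0 hhi]
    refine mul_le_mul_of_nonneg_left (mul_le_mul_of_nonneg_left ?_ hP) hW
    calc Real.log (hi / m) ≤ Real.log (hi / θ₀) := Real.log_le_log (by positivity) (div_le_div_of_nonneg_left hhi.le hθ₀ hθm)
      _ ≤ log⁺ (hi / θ₀) := by rw [Real.posLog_apply]; exact le_max_right _ _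
  calc (∫ e in lo..m, w e * I e) + ∫ e in m..hi, w e * I e
      ≤ W * ((Q + 2 * R) * θ₀ + 2 * S * Real.sqrt θ₀) + W * (P * log⁺ (hi / θ₀)) := add_le_add hsmall hlarge
    _ = W * ((Q + 2 * R) * θ₀ + 2 * S * Real.sqrt θ₀ + P * log⁺ (hi / θ₀)) := by ring

/-- **RELATIVE FOLD CLASS, ASSEMBLED** (the tangency window in the currency of `…C4aLoopNondegeneracy` + `…C4aTwoNodeCurvatureWindow`): a level family of
`C²` loop profiles with the uniform RELATIVE second-order dichotomy `|G e x − e| ≤ κ → |∂ₓG| < c₁ → c₂ ≤ |∂ₓ²G|`, ceilings `L₁, L₂`, `(b − a)·4L₁ ≤ N·κ`,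
`(b − a)·4L₂ ≤ N·c₁`, floors `t e ≥ e`, weight `0 ≤ w ≤ W` ⟹ `∫_{lo..hi} w(e)·(∫ dx/max(t e,|G e x|)) de ≤
W·((4(b−a)/κ + 8N/c₁)·(κ/2) + 2·(12N/√c₂)·√(κ/2) + (b − a)·log⁺(hi/(κ/2)))` — `lo`-free. [cite: Salmhofer1999, §4.5.3 Lemma 4.10; FeldmanSalmhoferTrubowitz1998, §3] -/
theorem level_loop_inv_envelope_le_of_rel_dichotomy_two (hab : a ≤ b) (hlo : 0 < lo) (hlohi : lo ≤ hi) {G : ℝ → ℝ → ℝ} {t w : ℝ → ℝ}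
    (hG : ∀ e ∈ Icc lo hi, ContDiff ℝ 2 (G e)) {κ c₁ c₂ L₁ L₂ W : ℝ} {N : ℕ} (hκ : 0 < κ) (hc₁ : 0 < c₁) (hc₂ : 0 < c₂) (hL₁ : 0 < L₁)
    (hL₂ : 0 < L₂) (hL : ∀ e ∈ Icc lo hi, ∀ x ∈ Icc a b, |deriv (G e) x| ≤ L₁) (hL' : ∀ e ∈ Icc lo hi, ∀ x ∈ Icc a b, |iteratedDeriv 2 (G e) x| ≤ L₂)
    (hdich : ∀ e ∈ Icc lo hi, ∀ x ∈ Icc a b, |G e x - e| ≤ κ → |deriv (G e) x| < c₁ → c₂ ≤ |iteratedDeriv 2 (G e) x|)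
    (hN : (b - a) * (4 * L₁) ≤ N * κ) (hN' : (b - a) * (4 * L₂) ≤ N * c₁)
    (ht : ∀ e ∈ Icc lo hi, e ≤ t e) (hW : 0 ≤ W) (hw0 : ∀ e ∈ Icc lo hi, 0 ≤ w e) (hw : ∀ e ∈ Icc lo hi, w e ≤ W) :
    ∫ e in lo..hi, w e * ∫ x in Icc a b, (max (t e) |G e x|)⁻¹ ≤
      W * ((4 * (b - a) / κ + 2 * (N * (4 / c₁))) * (κ / 2) + 2 * (12 * N / Real.sqrt c₂) * Real.sqrt (κ / 2) + (b - a) * log⁺ (hi / (κ / 2))) := by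
  have hte : ∀ e ∈ Icc lo hi, 0 < t e := fun e he => (hlo.trans_le he.1).trans_le (ht e he)
  have hsc : 0 < Real.sqrt c₂ := Real.sqrt_pos.2 hc₂
  refine intervalIntegral_level_layer_threshold_le hlo hlohi (w := w) (I := fun e => ∫ x in Icc a b, (max (t e) |G e x|)⁻¹) (θ₀ := κ / 2)
    (P := b - a) (Q := 4 * (b - a) / κ) (R := N * (4 / c₁)) (S := 12 * N / Real.sqrt c₂) (half_pos hκ) hW (by linarith) (by positivity)
    (by positivity) (by positivity) hw0 hw (fun e he => integral_inv_envelope_nonneg (G e) (hte e he) a b) ?_ ?_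
  · intro e he heκ
    have he0 : 0 < e := hlo.trans_le he.1
    have habs : |e| ≤ κ / 2 := by rw [abs_of_pos he0]; exact heκ
    have h := integral_inv_envelope_le_of_rel_dichotomy_two hab (hG e he) hκ hc₁ hc₂ hL₁ hL₂ (hL e he) (hL' e he) (hdich e he) hN hN' habs (hte e he)
    have hlog : log⁺ (κ / (4 * t e)) ≤ log⁺ (κ / 2 / (2 * e)) := by
      refine Real.posLog_le_posLog (div_nonneg hκ.le (by linarith [hte e he])) ?_
      rw [div_div]
      exact div_le_div_of_nonneg_left hκ.le (by positivity) (by nlinarith [ht e he])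
    have hsq : 12 * N / Real.sqrt (c₂ * t e) ≤ 12 * N / Real.sqrt c₂ * (Real.sqrt e)⁻¹ := by
      rw [Real.sqrt_mul hc₂.le, ← div_div, div_eq_mul_inv (12 * N / Real.sqrt c₂)]
      refine mul_le_mul_of_nonneg_left ?_ (by positivity)
      exact inv_anti₀ (Real.sqrt_pos.2 he0) (Real.sqrt_le_sqrt (ht e he))
    have hB : 0 ≤ (N : ℝ) * (4 / c₁) := by positivity
    exact h.trans (by nlinarith [mul_le_mul_of_nonneg_left hlog hB])
  · intro e he _
    have he0 : 0 < e := hlo.trans_le he.1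
    exact (integral_inv_envelope_le_trivial hab (G e) (hte e he)).trans (div_le_div_of_nonneg_left (by linarith) he0 (ht e he))

end Relative

end Summit.HubbardSuperconductivity.HubbardSuperconductivity.Theorems.C4a

end
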